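import Literature.AlgebraicGeometry.HodgeTheory.DirectImageEndomorphism
import Mathlib.LinearAlgebra.Determinant
import HarnessLib

/-!
# Unimodular monodromy on an eigenspace of `H¹` fixes its top cup-power line ("`Γ ⊂ SU` ⇒ the Weil classes are flat")

Family `hodge`, layer `Literature/AlgebraicGeometry/HodgeTheory`. Continuation of
`DirectImageEndomorphism` (transport `γ_*` in `Rᵏ π_* ℂ` commutes with an endomorphism `g` of the
family over the base and preserves the `g^*`-eigenspaces `V_μ ⊆ H¹(X_s)` and the spans
`Span(⌣ᵈ V_μ)`). This file proves the DETERMINANT criterion behind Deligne's remark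
"`Γ ⊂ SU`, so `det_E γ = 1`" ([Deligne1982HodgeCycles, proof of Thm. 4.8, p. 50];
[vanGeemen1994HodgeAV, 5.8–5.11]): if the monodromy `γ_*` of a loop at `s` has determinant `1` on
the `d`-dimensional eigenspace `V_μ(s)`, then it FIXES every class of the line
`Span{u₁ ⌣ ⋯ ⌣ u_d | uᵢ ∈ V_μ(s)} = ⋀ᵈ V_μ(s)` — the iterated cup product is alternating in its
degree-one arguments (`cupPowOneAlt`), and an alternating `d`-form on a `d`-dimensional space
transforms under an endomorphism by its determinant (`apply_eq_basis_det_smul_of_alternating`,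
the vector-valued form of Mathlib's `AlternatingMap.eq_smul_basis_det`, with `Basis.det_comp`).

* `transportFun_eq_self_of_det_restrict_eq_one` — the criterion for one loop and one eigenvalue;
* `transportFun_eq_self_of_det_restrict_eq_one_sup` — both Weil lines at once: `det = 1` on `V_μ`
  and on `V_ν` fixes `Span(⌣ᵈ V_μ) ⊔ Span(⌣ᵈ V_ν)` pointwise; combined with
  `exists_continuous_section_of_forall_transportFun_eq` (`GlobalInvariantCyclesSectionsProofs`) this
  turns "the monodromy of the family is special unitary on `H¹`" into the continuous Weil sections
  required by `HodgeTheory.deligne1982_weilFamily_globalAction` / `…_hodgeWeilSection`.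

No definition, no named fact.

## References

* [Deligne1982HodgeCycles] P. Deligne (notes by J. S. Milne), Hodge cycles on abelian varieties,
  LNM 900 (1982), proof of Thm. 4.8, p. 50.
* [vanGeemen1994HodgeAV] B. van Geemen, An introduction to the Hodge conjecture for abelian
  varieties, LNM 1594 (1994), 5.8–5.11.
-/

noncomputable section

open CategoryTheory AlgebraicGeometry
open Literature.AlgebraicTopology.SingularHomology

namespace Literature.AlgebraicGeometry.HodgeTheory

section HodgeTheory

/-! ### An alternating `d`-form on a module with a `d`-element basis transforms by the determinant -/

/-- **Vector-valued form of `AlternatingMap.eq_smul_basis_det`**: for an alternating map `f`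
indexed by `ι` and a basis `e` indexed by `ι`, `f v = det_e(v) · f e`. [folklore] -/
theorem apply_eq_basis_det_smul_of_alternating {R M N ι : Type*} [CommRing R] [AddCommGroup M]
    [Module R M] [AddCommGroup N] [Module R N] [Fintype ι] [DecidableEq ι]
    (f : M [⋀^ι]→ₗ[R] N) (e : Module.Basis ι R M) (v : ι → M) : f v = e.det v • f e := by
  have h : f = (e.det).smulRight (f e) := by
    refine Module.Basis.ext_alternating e fun i hi => ?_
    let σ : Equiv.Perm ι := Equiv.ofBijective i (Finite.injective_iff_bijective.1 hi)
    change f (e ∘ σ) = (e.det.smulRight (f e)) (e ∘ σ)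
    rw [AlternatingMap.smulRight_apply, AlternatingMap.map_perm, AlternatingMap.map_perm,
      Module.Basis.det_self, Units.smul_def, Units.smul_def, smul_assoc, one_smul]
  conv_lhs => rw [h]
  rw [AlternatingMap.smulRight_apply]

/-- Hence **an endomorphism acts on the values of an alternating `d`-form on a module with a
`d`-element basis by its determinant**: `f (M ∘ v) = det M · f v`. [folklore] -/
theorem apply_comp_eq_det_smul_of_alternating {R M N ι : Type*} [CommRing R] [AddCommGroup M]
    [Module R M] [AddCommGroup N] [Module R N] [Fintype ι] [DecidableEq ι]
    (f : M [⋀^ι]→ₗ[R] N) (e : Module.Basis ι R M) (T : M →ₗ[R] M) (v : ι → M) :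
    f (T ∘ v) = LinearMap.det T • f v := by
  rw [apply_eq_basis_det_smul_of_alternating f e (T ∘ v), Module.Basis.det_comp, mul_smul,
    ← apply_eq_basis_det_smul_of_alternating f e v]

/-! ### Unimodular monodromy fixes the Weil line -/

variable {𝒳 S : Motives.SchemeOver ℂ} (π : 𝒳 ⟶ S) {U : Set (Motives.ComplexPoints S)}

/-- **`det = 1` on `V_μ` ⇒ the line `⋀ᵈ V_μ` is fixed.** Let `g ≫ π = π` with fibre maps `g_t`,
`γ` a loop at `s` in a cohomologically locally trivial `U`, `V_μ(s)` the `μ`-eigenspace of `g_s^*`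
on `H¹(X_s(ℂ); ℂ)` — stable under `γ_*` (`transportFun_mem_eigenspace_fiberHom`) — with a basis of
`d` elements, and suppose `γ_*|_{V_μ(s)}` has determinant `1`. Then `γ_*` fixes every class of
`Span{u₁ ⌣ ⋯ ⌣ u_d | uᵢ ∈ V_μ(s)}`: `γ_*(u₁ ⌣ ⋯ ⌣ u_d) = γ_*u₁ ⌣ ⋯ ⌣ γ_*u_d =
det(γ_*|_{V_μ}) · (u₁ ⌣ ⋯ ⌣ u_d)` (the cup product of degree-one classes is alternating,
`cupPowOneAlt`). This is "`Γ ⊂ SU`, so `det_E γ = 1` [and the Weil class is invariant]".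
[cite: Deligne1982HodgeCycles, proof of Thm. 4.8, p. 50] [cite: vanGeemen1994HodgeAV, 5.8–5.11] -/
theorem transportFun_eq_self_of_det_restrict_eq_one (hU : IsCohomologicallyLocallyTrivialOn π U)
    (g : 𝒳 ⟶ 𝒳) (hg : g ≫ π = π)
    (gf : ∀ t : Motives.ComplexPoints S, Motives.fiberOver π t ⟶ Motives.fiberOver π t)
    (hgf : ∀ t, gf t ≫ Motives.fiberι π t = Motives.fiberι π t ≫ g)
    {s : U} (γ : Path.Homotopic.Quotient s s) (μ : ℂ) {d : ℕ}
    (b : Module.Basis (Fin d) ℂ (Module.End.eigenspace (complexBetti.map (gf s.1) 1).hom μ))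
    (hdet : LinearMap.det ((transportLinear π 1 hU γ).restrict
      (p := Module.End.eigenspace (complexBetti.map (gf s.1) 1).hom μ)
      (q := Module.End.eigenspace (complexBetti.map (gf s.1) 1).hom μ)
      (fun _ hv ↦ transportFun_mem_eigenspace_fiberHom π 1 hU g hg gf hgf γ hv)) = 1)
    {α : complexBetti (Motives.fiberOver π s.1) d}
    (hα : α ∈ Submodule.span ℂ
      {x | ∃ w : Fin d → complexBetti (Motives.fiberOver π s.1) 1,
        (∀ i, w i ∈ Module.End.eigenspace (complexBetti.map (gf s.1) 1).hom μ) ∧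
        cupPowOne ℂ (Motives.ComplexPoints (Motives.fiberOver π s.1)) d w = x}) :
    transportFun π d hU γ α = α := by
  set V := Module.End.eigenspace (complexBetti.map (gf s.1) 1).hom μ with hV
  set T : V →ₗ[ℂ] V := (transportLinear π 1 hU γ).restrict (p := V) (q := V)
    (fun _ hv ↦ transportFun_mem_eigenspace_fiberHom π 1 hU g hg gf hgf γ hv) with hT
  let F : V [⋀^Fin d]→ₗ[ℂ] complexBetti (Motives.fiberOver π s.1) d :=
    (cupPowOneAlt ℂ (Motives.ComplexPoints (Motives.fiberOver π s.1)) d).compLinearMap V.subtype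
  have hF : ∀ w' : Fin d → V,
      F w' = cupPowOne ℂ (Motives.ComplexPoints (Motives.fiberOver π s.1)) d (fun i ↦ (w' i : _)) :=
    fun w' ↦ by
      change cupPowOneAlt ℂ _ d (V.subtype ∘ w') = _
      rw [cupPowOneAlt_apply]
      rfl
  induction hα using Submodule.span_induction with
  | mem x hx =>
    obtain ⟨w, hw, rfl⟩ := hx
    let w' : Fin d → V := fun i ↦ ⟨w i, hw i⟩
    have h1 : cupPowOne ℂ (Motives.ComplexPoints (Motives.fiberOver π s.1)) d w = F w' := (hF w').symm
    have h2 : transportFun π d hU γ (cupPowOne ℂ (Motives.ComplexPoints (Motives.fiberOver π s.1)) d w) =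
        F (T ∘ w') := by
      rw [transportFun_cupPowOne, hF]
      rfl
    rw [h2, apply_comp_eq_det_smul_of_alternating F b T w', hdet, one_smul, ← h1]
  | zero =>
    have h := transportFun_smul π d hU γ (0 : ℂ) 0
    rwa [zero_smul, zero_smul] at h
  | add x y _ _ hx hy => rw [transportFun_add, hx, hy]
  | smul c x _ hx => rw [transportFun_smul, hx]

/-- **Both Weil lines at once**: if `γ_*` has determinant `1` on `V_μ(s)` and on `V_ν(s)` (bases of
`d` elements each), it fixes `Span(⌣ᵈ V_μ) ⊔ Span(⌣ᵈ V_ν)` pointwise — for the `±i√p`-eigenspaces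
of the global `√-p` of an abelian scheme of relative dimension `d = 2k` this is the invariance of
the whole Weil plane under special-unitary monodromy, the input of
`exists_continuous_section_of_forall_transportFun_eq`.
[cite: Deligne1982HodgeCycles, proof of Thm. 4.8, p. 50] [cite: vanGeemen1994HodgeAV, 5.8–5.11] -/
theorem transportFun_eq_self_of_det_restrict_eq_one_sup (hU : IsCohomologicallyLocallyTrivialOn π U)
    (g : 𝒳 ⟶ 𝒳) (hg : g ≫ π = π)
    (gf : ∀ t : Motives.ComplexPoints S, Motives.fiberOver π t ⟶ Motives.fiberOver π t)
    (hgf : ∀ t, gf t ≫ Motives.fiberι π t = Motives.fiberι π t ≫ g)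
    {s : U} (γ : Path.Homotopic.Quotient s s) (μ ν : ℂ) {d : ℕ}
    (bμ : Module.Basis (Fin d) ℂ (Module.End.eigenspace (complexBetti.map (gf s.1) 1).hom μ))
    (bν : Module.Basis (Fin d) ℂ (Module.End.eigenspace (complexBetti.map (gf s.1) 1).hom ν))
    (hdetμ : LinearMap.det ((transportLinear π 1 hU γ).restrict
      (p := Module.End.eigenspace (complexBetti.map (gf s.1) 1).hom μ)
      (q := Module.End.eigenspace (complexBetti.map (gf s.1) 1).hom μ)
      (fun _ hv ↦ transportFun_mem_eigenspace_fiberHom π 1 hU g hg gf hgf γ hv)) = 1)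
    (hdetν : LinearMap.det ((transportLinear π 1 hU γ).restrict
      (p := Module.End.eigenspace (complexBetti.map (gf s.1) 1).hom ν)
      (q := Module.End.eigenspace (complexBetti.map (gf s.1) 1).hom ν)
      (fun _ hv ↦ transportFun_mem_eigenspace_fiberHom π 1 hU g hg gf hgf γ hv)) = 1)
    {α : complexBetti (Motives.fiberOver π s.1) d}
    (hα : α ∈ Submodule.span ℂ
        {x | ∃ w : Fin d → complexBetti (Motives.fiberOver π s.1) 1,
          (∀ i, w i ∈ Module.End.eigenspace (complexBetti.map (gf s.1) 1).hom μ) ∧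
          cupPowOne ℂ (Motives.ComplexPoints (Motives.fiberOver π s.1)) d w = x} ⊔
      Submodule.span ℂ
        {x | ∃ w : Fin d → complexBetti (Motives.fiberOver π s.1) 1,
          (∀ i, w i ∈ Module.End.eigenspace (complexBetti.map (gf s.1) 1).hom ν) ∧
          cupPowOne ℂ (Motives.ComplexPoints (Motives.fiberOver π s.1)) d w = x}) :
    transportFun π d hU γ α = α := by
  obtain ⟨a, ha, c, hc, rfl⟩ := Submodule.mem_sup.1 hα
  rw [transportFun_add, transportFun_eq_self_of_det_restrict_eq_one π hU g hg gf hgf γ μ bμ hdetμ ha,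
    transportFun_eq_self_of_det_restrict_eq_one π hU g hg gf hgf γ ν bν hdetν hc]

end HodgeTheory

end Literature.AlgebraicGeometry.HodgeTheory

end
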